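import Literature.Geometry.Symplectic.TaubesCanonicalSolution
import Literature.Geometry.GaugeTheory.SeibergWittenGaugeInvariance
import HarnessLib

/-!
# The Dirac equation of Taubes's `r`-family in the splitting `ψ = α u₀ + β`: Taubes 1995, (5.4)

Topic `Literature/Geometry/Symplectic`; continues `TaubesCanonicalSolution` (canonical `Spin^c`
structure `𝔰_J` of `(N, s, J)`, the unit section `u₀` of `I ⊂ S₊ = I ⊕ K⁻¹`, Taubes's connection
`A₀` on `K⁻¹` and — for `ds = 0` — `D_{A₀} u₀ = 0`, Taubes 1994 Lemma 1) with the Dirac calculus of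
`GaugeTheory/SpincConnection`, `GaugeTheory/SeibergWittenGaugeInvariance` (`∂_A` additive, Leibniz
`∂_A(fψ) = df·ψ + f ∂_Aψ`, change of connection `∂_{A + iα}ψ = ∂_Aψ + ½(iα)·ψ`).

Taubes 1995, §5 (p. 234): "it proves convenient to rewrite `ψ` as (5.3) `ψ = r^{1/2}·(α·u₀ + β)`,
where `α` is a section of `E` and where `β` is a section of `K⁻¹ ⊗ E`.  Noting that `u₀` is a
solution to the Dirac equation `D_{A₀} u₀ = 0`, one can rewrite the first equation in (5.2) as
(5.4) `σ(u₀ ⊗ ∇_a α) + D_A β = 0`, where `∇_a` is the induced covariant derivative which is induced on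
`E` from the covariant derivatives `∇_{A₀}` on `K⁻¹` and `∇_A` on `K⁻¹ ⊗ E²`. (Note that
`F_a = 2⁻¹·(F_A - F_{A₀})`.)" (Taubes 1994, §3 (14): "`∂̄_a α + …`", with `A = A₀ + i·a`,
`∇_a = d + i·a` on functions.)

Here `E` is trivial, `A = A₀ + i·a` (`addForm`), `α : N → ℂ`, `β` any (positive) spinor field, and
the identity holds pointwise in every chart `x₀` of `𝔰_J` (unitary frame `e`, `u₀ = plusUnit`):

* **`dirac_addForm_smul_canonicalSpinor_add`** (**(5.4)**):
  `D_A(α u₀ + β) = (dα + (i/2) α a)·u₀ + D_A β`, i.e. `σ(u₀ ⊗ ∇_a α) + D_A β` with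
  `∇_a α = dα + (i/2)αa` (the connection `a/2` on `E`: `F_a = ½(F_A - F_{A₀})`) and
  `D_A β = D_{A₀}β + ½(ia)·β`; here `(θ)·u₀` is Clifford multiplication `Σ_k θ(e_k) γ_k u₀`;
* `dirac_addForm_smul_canonicalSpinor_add_eq_zero_iff`: so `D_A ψ = 0 ⟺ σ(u₀ ⊗ ∇_a α) = -D_A β`.

PROVED, 0 named facts.

## References

* C. H. Taubes, *The Seiberg–Witten and Gromov invariants*, Math. Res. Lett. 2 (1995) 221–238,
  §5 (5.3)–(5.4) (p. 234). [Taubes1995]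
* C. H. Taubes, *The Seiberg–Witten invariants and symplectic forms*, Math. Res. Lett. 1 (1994)
  809–822, §3 Step 1 (14)–(15). [Taubes1994]
* J. W. Morgan, *The Seiberg–Witten Equations …* (1996), §3.3, Lemma 3.3.2, Claim 4.6.1. [MorganSWBook1996]
-/

noncomputable section

open scoped Manifold ContDiff ComplexConjugate Matrix
open Set Complex Literature.Geometry.Kaehler Literature.Geometry.GaugeTheory Literature.Topology.FourManifolds
open Literature.Geometry.Lorentzian (PseudoRiemannianMetric)
open Literature.Geometry.GaugeTheory.SpincStructure

namespace Literature.Geometry.Symplectic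

namespace AlmostComplexStructure.IsCompatibleWith

variable {N : Type*} [TopologicalSpace N] [ChartedSpace (EuclideanSpace ℝ (Fin 4)) N]
  [IsManifold (𝓡 4) ∞ N] {J : AlmostComplexStructure (𝓡 4) ∞ N} {s : MForm (𝓡 4) N ℝ 2}
  (h : J.IsCompatibleWith s) (hs : IsSmoothForm s)
  (hnd : ∀ x (v : TangentSpace (𝓡 4) x), v ≠ 0 → ∃ w : TangentSpace (𝓡 4) x, s x ![v, w] ≠ 0)

/-- The local representatives of `u₀` are constant (`plusUnit`), hence differentiable. [folklore] -/
theorem spinorMDiffAt_canonicalSpinor (x₀ x : N) : SpinorMDiffAt ((h.canonicalSpinor hs hnd).toFun x₀) x :=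
  fun _ ↦ mdifferentiableAt_const

/-- The local representatives of `α u₀` are `α · plusUnit`, differentiable where `α` is. [folklore] -/
theorem spinorMDiffAt_smul_canonicalSpinor {α : N → ℂ} {x : N} (hα : MDifferentiableAt (𝓡 4) 𝓘(ℝ, ℂ) α x)
    (x₀ : N) : SpinorMDiffAt ((α • h.canonicalSpinor hs hnd).toFun x₀) x := fun a ↦ by
  simp only [SpinorField.smulFun_toFun, canonicalSpinor_toFun, Pi.smul_apply, smul_eq_mul]
  exact hα.mul mdifferentiableAt_const

variable [(h.metric hs).HasLeviCivita]

/-- **Taubes 1995, (5.4): the Dirac operator of `A = A₀ + i·a` on `ψ = α u₀ + β`.**  On `(N, s, J)`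
with `ds = 0` (so `D_{A₀} u₀ = 0`, Taubes 1994 Lemma 1), for a smooth real 1-form `a`, a complex
function `α` and a spinor field `β` differentiable at `x`, in the chart `x₀ ∋ x` of the canonical
`Spin^c` structure:
`D_A(α u₀ + β)(x) = (dα)·u₀ + (i/2) α (a·u₀) + (D_{A₀} β + ½ (ia)·β) = σ(u₀ ⊗ ∇_a α) + D_A β`,
`∇_a α = dα + (i/2) α a`. [cite: Taubes1995, §5 (5.4) (p. 234)] -/
theorem dirac_addForm_smul_canonicalSpinor_add (hcl : IsClosedForm s) (a : RealOneForm N) (ha : ∀ x, a.SmoothAt x)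
    {α : N → ℂ} (β : SpinorField (h.canonicalSpincStructure hs hnd)) (x₀ : N) {x : N}
    (hx : x ∈ (h.canonicalSpincStructure hs hnd).baseSet x₀)
    (hα : MDifferentiableAt (𝓡 4) 𝓘(ℝ, ℂ) α x) (hβ : SpinorMDiffAt (β.toFun x₀) x) :
    dirac ((h.taubesConnection hs hnd).addForm a ha) (α • h.canonicalSpinor hs hnd + β) x₀ x =
      cliffordComplexOneForm (fun y w ↦ complexDeriv α y w) x (fun k ↦ (h.canonicalSpincStructure hs hnd).frame x₀ k x)
          *ᵥ plusUnit
        + ((2 : ℂ)⁻¹ * I * α x) • (cliffordOneForm a x (fun k ↦ (h.canonicalSpincStructure hs hnd).frame x₀ k x) *ᵥ plusUnit)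
        + (dirac (h.taubesConnection hs hnd) β x₀ x
            + ((2 : ℂ)⁻¹ * I) • (cliffordOneForm a x (fun k ↦ (h.canonicalSpincStructure hs hnd).frame x₀ k x)
                *ᵥ β.toFun x₀ x)) := by
  rw [dirac_add _ (h.spinorMDiffAt_smul_canonicalSpinor hs hnd hα x₀) hβ,
    dirac_smul_fun _ hα (h.spinorMDiffAt_canonicalSpinor hs hnd x₀ x), dirac_addForm, dirac_addForm,
    h.dirac_taubesConnection_canonicalSpinor_eq_zero hs hnd hcl x₀ hx, zero_add, canonicalSpinor_toFun, smul_smul]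
  ring_nf

/-- **The Dirac equation of the family in the splitting**: `D_A(α u₀ + β) = 0` iff
`σ(u₀ ⊗ ∇_a α) = -D_A β`, i.e. `(dα)·u₀ + (i/2)α(a·u₀) = -(D_{A₀}β + ½(ia)·β)`.
[cite: Taubes1995, §5 (5.4) (p. 234)] -/
theorem dirac_addForm_smul_canonicalSpinor_add_eq_zero_iff (hcl : IsClosedForm s) (a : RealOneForm N)
    (ha : ∀ x, a.SmoothAt x) {α : N → ℂ} (β : SpinorField (h.canonicalSpincStructure hs hnd)) (x₀ : N) {x : N}
    (hx : x ∈ (h.canonicalSpincStructure hs hnd).baseSet x₀)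
    (hα : MDifferentiableAt (𝓡 4) 𝓘(ℝ, ℂ) α x) (hβ : SpinorMDiffAt (β.toFun x₀) x) :
    dirac ((h.taubesConnection hs hnd).addForm a ha) (α • h.canonicalSpinor hs hnd + β) x₀ x = 0 ↔
      cliffordComplexOneForm (fun y w ↦ complexDeriv α y w) x (fun k ↦ (h.canonicalSpincStructure hs hnd).frame x₀ k x)
            *ᵥ plusUnit
          + ((2 : ℂ)⁻¹ * I * α x) • (cliffordOneForm a x (fun k ↦ (h.canonicalSpincStructure hs hnd).frame x₀ k x) *ᵥ plusUnit) =
        -(dirac (h.taubesConnection hs hnd) β x₀ x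
            + ((2 : ℂ)⁻¹ * I) • (cliffordOneForm a x (fun k ↦ (h.canonicalSpincStructure hs hnd).frame x₀ k x)
                *ᵥ β.toFun x₀ x)) := by
  rw [h.dirac_addForm_smul_canonicalSpinor_add hs hnd hcl a ha β x₀ hx hα hβ, add_eq_zero_iff_eq_neg]

end AlmostComplexStructure.IsCompatibleWith

end Literature.Geometry.Symplectic

end
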